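import Summits.SmoothPoincare4.SmoothPoincare4.Theorems.DottedCircleRasmussenDcrGapHelperFriendsCarrierTkAux8

/-!
# Helper `helper_friendsCarrier_Tk_endLeftInverse` of stub `helper_friendsCarrier_Tk` — the end collar, part 2: `collarInv ∘ collar = id`
(item stmt-SmoothPoincare4-16128, route route-SmoothPoincare4-DottedCircleRasmussen)

Continuation of `…TkAux8` (end collar, part 1: `EndDatum`, `Presentation`, the collar formulas),
porting the sections *Computations in coordinates* and *`collarInv ∘ collar = id`* of the tree's
`OpenTraceCollar.lean`: the branch evaluation of `collarInv`, the values of the base/profile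
coordinates at collar points (`baseP_apply`, `Φ_baseP`, `profP_ptT_arg`, `ΨTube_ptT_arg`, `ΨRad_ptA_arg`),
and the three cases `collarInv_collar_rad/tube/core` of **`collarInv (collar p) = p`** — by the closed
forms of the profile `Φ` and its inverse in the radial and flat regimes (`TraceCollarProfile.lean`).

* `EndDatum.Presentation.collarInv_collar` — `collarInv ∘ collar = id` on `Y × ℝ` (so the collar is
  injective);
* `helper_friendsCarrier_Tk_endLeftInverse` — the registered summary.

Everything is proved; no named facts, no `sorry`.
References: Kirby (1989), Ch. I §5 [Kirby1989]; the tree's `OpenTraceCollar.lean`, `TraceCollarProfile.lean`.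
-/

-- the prescribed namespace `Summit.<P>.<Sub>.…` duplicates `SmoothPoincare4` (P = Sub)
set_option linter.dupNamespace false
set_option linter.style.longLine false

noncomputable section

open scoped Manifold ContDiff Topology
open Function Set Metric
open Literature.Topology.FourManifolds Literature.Topology.FourManifolds.MMSW

namespace Summit.SmoothPoincare4.SmoothPoincare4.Theorems.DcrGap.MkFriends

namespace FriendsTk

namespace EndDatum

variable {k : ℕ} (E : EndDatum k)

/-! ### Branch evaluation of the inverse collar -/

/-- `incl y ∈ radSetT` iff `y` is a band point outside `D_k` whose drop is outside the closed tube
(`y ∈ P`). [folklore] -/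
theorem incl_mem_radSetT_iff {y : EuclideanSpace ℝ (Fin 4)} (hy : y ∈ E.hbNbhd) :
    E.incl y ∈ E.radSetT ↔ 1 < levelFun k y ∧ E.dropA y ∉ E.closedTube := by
  constructor
  · rintro ⟨y', ⟨hy', h1, h2⟩, h⟩
    rw [E.injOn_incl hy' hy h] at h1 h2
    exact ⟨h1, h2⟩
  · exact fun h => ⟨y, ⟨hy, h.1, h.2⟩, rfl⟩

/-- **Branch R'**. [folklore] -/
theorem collarInv_incl_of_not_mem {Y : Type*} (jM : EuclideanSpace ℝ (Fin 4) → Y) (jB : ↥solidTorus → Y)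
    {y : EuclideanSpace ℝ (Fin 4)} (hy : y ∈ E.hbNbhd) (h1 : 1 < levelFun k y) (h : E.dropA y ∉ E.closedTube) :
    E.collarInv jM jB (E.incl y) = E.ΨRad jM y := by
  rw [collarInv, if_pos ((E.incl_mem_radSetT_iff hy).2 ⟨h1, h⟩), E.πl_incl hy]

/-- **Branch P'**. [folklore] -/
theorem collarInv_incl_of_mem {Y : Type*} (jM : EuclideanSpace ℝ (Fin 4) → Y) (jB : ↥solidTorus → Y)
    {y : EuclideanSpace ℝ (Fin 4)} (hy : y ∈ E.hbNbhd) (h : E.dropA y ∈ E.closedTube) :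
    E.collarInv jM jB (E.incl y) = E.ΨTube jM y := by
  rw [collarInv, if_neg (fun h' => ((E.incl_mem_radSetT_iff hy).1 h').2 h), if_pos ⟨y, hy, rfl⟩, E.πl_incl hy]

/-- **Branch F'** (the cocore). [folklore] -/
theorem collarInv_inr_zero {Y : Type*} (jM : EuclideanSpace ℝ (Fin 4) → Y) (jB : ↥solidTorus → Y) (w : EuclideanSpace ℝ (Fin 2)) :
    E.collarInv jM jB (E.trGlueData.inr (0, w)) = TubeNbhd.ΨFlat jB ((0 : EuclideanSpace ℝ (Fin 2)), w) := by
  have h1 : E.trGlueData.inr ((0 : EuclideanSpace ℝ (Fin 2)), w) ∉ E.incl '' E.hbNbhd := by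
    rw [E.inr_mem_image_incl_iff]; simp
  have h2 : E.trGlueData.inr ((0 : EuclideanSpace ℝ (Fin 2)), w) ∉ E.radSetT := fun h => h1 (by
    obtain ⟨y, hy, hyw⟩ := h; exact ⟨y, hy.1, hyw⟩)
  rw [collarInv, if_neg h2, if_neg h1, E.πr_inr]


/-! ### Computations in coordinates -/

/-- `θ(s, a) ∈ P` for `a ∈ M_k`, `|s| < δ`. [folklore] -/
theorem θ_mem_hbNbhd_of_mem {a : EuclideanSpace ℝ (Fin 4)} (ha : a ∈ modelBoundary k) {s : ℝ} (hs : s ∈ Ioo (-E.δ) E.δ) :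
    E.θ (s, a) ∈ E.hbNbhd := by
  obtain ⟨-, -, hG⟩ := E.dropA_radA_θ ha hs
  have hg : ∀ j, (1 : ℝ) / 2 < holeTerm k j a := fun j => lt_of_lt_of_le (by norm_num) (ha.1 j)
  have hGa : levelFun k a ∈ Ioo (1 - E.δ) (1 + E.δ) := by rw [ha.2]; exact ⟨by linarith [E.δ_pos], by linarith [E.δ_pos]⟩
  have h := (E.clock a hg hGa s (by rw [ha.2]; exact ⟨by linarith [hs.1], by linarith [hs.2]⟩)).1
  exact ⟨h, by rw [hG]; linarith [hs.2]⟩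

/-- The base coordinates over the tube point `ν₀ (u, w)`: `Φ⁻¹ (e^{-σ}, ‖w‖)`. [folklore] -/
theorem baseP_apply (u : Metric.sphere (0 : EuclideanSpace ℝ (Fin 2)) 1) (w : EuclideanSpace ℝ (Fin 2)) (σ : ℝ) :
    E.baseP (E.ν₀ (u, w)) σ = TraceCollar.Φinv (Real.exp (-σ), ‖w‖) := by
  rw [baseP, E.ι₀_ν₀]

/-- The base coordinates over a tube point off the knot have `X > 0`. [folklore] -/
theorem baseP_mem_Ωpos (u : Metric.sphere (0 : EuclideanSpace ℝ (Fin 2)) 1) {w : EuclideanSpace ℝ (Fin 2)} (hw : w ≠ 0) (σ : ℝ) :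
    E.baseP (E.ν₀ (u, w)) σ ∈ TraceCollar.Ωpos := by
  rw [baseP_apply]; exact TraceCollar.Φinv_mem (TubeNbhd.mem_Quad_of_ne_zero σ hw)

/-- `Φ (Φ⁻¹ (e^{-σ}, ‖w‖)) = (e^{-σ}, ‖w‖)` for `w ≠ 0`. [folklore] -/
theorem Φ_baseP (u : Metric.sphere (0 : EuclideanSpace ℝ (Fin 2)) 1) {w : EuclideanSpace ℝ (Fin 2)} (hw : w ≠ 0) (σ : ℝ) :
    TraceCollar.Φ (E.baseP (E.ν₀ (u, w)) σ) = (Real.exp (-σ), ‖w‖) := by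
  rw [baseP_apply]; exact TraceCollar.Φ_Φinv (TubeNbhd.mem_Quad_of_ne_zero σ hw)

/-- Over the closed tube (off the knot) the height base coordinate `Y` is nonnegative. [folklore] -/
theorem snd_baseP_nonneg (u : Metric.sphere (0 : EuclideanSpace ℝ (Fin 2)) 1) {w : EuclideanSpace ℝ (Fin 2)} (hw : w ≠ 0)
    (hw2 : ‖w‖ ≤ 2) (σ : ℝ) : 0 ≤ (E.baseP (E.ν₀ (u, w)) σ).2 :=
  TubeNbhd.snd_nonneg_of_Φ_snd_le_two (E.baseP_mem_Ωpos u hw σ) (by rw [E.Φ_baseP u hw σ]; exact hw2)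

/-- The tube formula at `ν₀ (u, w)` in terms of the base coordinates. [folklore] -/
theorem cTube_apply (u : Metric.sphere (0 : EuclideanSpace ℝ (Fin 2)) 1) (w : EuclideanSpace ℝ (Fin 2)) (σ : ℝ) :
    E.cTube (E.ν₀ (u, w)) σ = E.ptT (TraceCollar.αof (E.baseP (E.ν₀ (u, w)) σ).1)
      (2 * Real.exp (-(E.baseP (E.ν₀ (u, w)) σ).2)) u (radialProjection (spherePt 1) w) := by
  rw [cTube, E.ι₀_ν₀]

/-- The drop, the handle radius and the level of the collar point `θ(s(α), a)`, `a ∈ M_k`, `α > 0`. [folklore] -/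
theorem dropA_radA_ptA_arg {a : EuclideanSpace ℝ (Fin 4)} (ha : a ∈ modelBoundary k) {α : ℝ} (hα : 0 < α) :
    E.dropA (E.θ (E.collarTime α, a)) = a ∧ E.radA (E.θ (E.collarTime α, a)) = α ∧
      levelFun k (E.θ (E.collarTime α, a)) = 1 + E.collarTime α := by
  obtain ⟨h1, h2, h3⟩ := E.dropA_radA_θ ha (E.collarTime_mem_Ioo hα)
  exact ⟨h1, by rw [h2, E.handleRadius_collarTime hα.le], h3⟩

/-- The profile values at the collar point `θ(s(α), ν₀(u, r v))`. [folklore] -/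
theorem profP_ptT_arg {α r : ℝ} (hα : 0 < α) (hr : 0 < r) (u v : Metric.sphere (0 : EuclideanSpace ℝ (Fin 2)) 1) :
    E.profP (E.θ (E.collarTime α, E.ν₀ (u, r • (v : EuclideanSpace ℝ (Fin 2))))) =
      TraceCollar.Φ (TraceCollar.ξ α, Real.log (2 / r)) := by
  obtain ⟨h1, h2, -⟩ := E.dropA_radA_ptA_arg (E.ν₀_mem (u, r • (v : EuclideanSpace ℝ (Fin 2)))) hα
  rw [profP, h2, h1, E.ι₀_ν₀, norm_smul_coe_sphere hr.le]

/-- The tube inverse formula at the collar point `θ(s(α), ν₀(u, r v))`. [folklore] -/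
theorem ΨTube_ptT_arg {Y : Type*} (jM : EuclideanSpace ℝ (Fin 4) → Y) {α r : ℝ} (hα : 0 < α) (hr : 0 < r)
    (u v : Metric.sphere (0 : EuclideanSpace ℝ (Fin 2)) 1) :
    E.ΨTube jM (E.θ (E.collarTime α, E.ν₀ (u, r • (v : EuclideanSpace ℝ (Fin 2))))) =
      (E.ptY jM (TraceCollar.Φ (TraceCollar.ξ α, Real.log (2 / r))).2 u v,
        -Real.log (TraceCollar.Φ (TraceCollar.ξ α, Real.log (2 / r))).1) := by
  obtain ⟨h1, -, -⟩ := E.dropA_radA_ptA_arg (E.ν₀_mem (u, r • (v : EuclideanSpace ℝ (Fin 2)))) hα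
  rw [ΨTube, E.profP_ptT_arg hα hr]
  simp only [h1, E.ι₀_ν₀, radialProjection_smul _ hr]

/-- The radial inverse formula at the collar point `θ(s(α), a)`, `a ∈ M_k`, `α > 0`. [folklore] -/
theorem ΨRad_ptA_arg {Y : Type*} (jM : EuclideanSpace ℝ (Fin 4) → Y) {a : EuclideanSpace ℝ (Fin 4)} (ha : a ∈ modelBoundary k)
    {α : ℝ} (hα : 0 < α) : E.ΨRad jM (E.θ (E.collarTime α, a)) = (jM a, -Real.log (TraceCollar.ξ α)) := by
  obtain ⟨h1, h2, -⟩ := E.dropA_radA_ptA_arg ha hα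
  rw [ΨRad, h1, h2]

/-! ### `collarInv ∘ collar = id` -/

namespace Presentation

variable {E} {Y : Type*} [TopologicalSpace Y] [ChartedSpace (EuclideanSpace ℝ (Fin 3)) Y] (P : E.Presentation Y)

/-- **Branch R**: `collarInv (collar (jM a, σ)) = (jM a, σ)` outside the closed tube. [folklore] -/
theorem collarInv_collar_rad {a : EuclideanSpace ℝ (Fin 4)} (ha : a ∈ modelBoundary k) (hat : a ∉ E.closedTube) (σ : ℝ) :
    E.collarInv P.jM P.jB (E.collar P.jM P.jB P.ψ (P.jM a, σ)) = (P.jM a, σ) := by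
  have hD : 0 < Real.exp (-σ) := Real.exp_pos _
  have hα : 0 < TraceCollar.αof (Real.exp (-σ)) := TraceCollar.αof_pos hD
  have hα1 : TraceCollar.αof (Real.exp (-σ)) < 1 := TraceCollar.αof_lt_one _
  have hs := E.collarTime_mem_Ioo hα
  obtain ⟨h1, -, h3⟩ := E.dropA_radA_ptA_arg ha hα
  have hpos : 0 < E.collarTime (TraceCollar.αof (Real.exp (-σ))) := by
    by_contra h; push Not at h
    exact absurd ((E.collarTime_nonpos_iff hα.le).1 h) (not_le.2 hα1)
  rw [P.collar_of_not_mem_closedTube ha hat, cRad, ptA,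
    E.collarInv_incl_of_not_mem P.jM P.jB (E.θ_mem_hbNbhd_of_mem ha hs) (by rw [h3]; linarith) (by rw [h1]; exact hat),
    E.ΨRad_ptA_arg P.jM ha hα, TraceCollar.ξ_αof, Real.log_exp, neg_neg]

/-- **Branch P**: `collarInv (collar (jM a, σ)) = (jM a, σ)` over the closed tube (off the knot). [folklore] -/
theorem collarInv_collar_tube {a : EuclideanSpace ℝ (Fin 4)} (ha' : a ∉ range E.K₀) (hat : a ∈ E.closedTube) (σ : ℝ) :
    E.collarInv P.jM P.jB (E.collar P.jM P.jB P.ψ (P.jM a, σ)) = (P.jM a, σ) := by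
  have ha : a ∈ modelBoundary k := E.closedTube_subset_modelBoundary hat
  -- write `a = ν₀ (u, w)` with `0 < ‖w‖ ≤ 2`
  obtain ⟨⟨u, w⟩, ⟨-, hw2⟩, hqa⟩ := hat
  rw [Metric.mem_closedBall, dist_zero_right] at hw2
  have hw : w ≠ 0 := fun h => ha' (by rw [← hqa, h]; exact (E.ν₀_mem_range_iff).2 rfl)
  have hwpos : 0 < ‖w‖ := norm_pos_iff.2 hw
  subst hqa
  set q := E.baseP (E.ν₀ (u, w)) σ with hq
  have hX : 0 < q.1 := E.baseP_mem_Ωpos u hw σ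
  have hY : 0 ≤ q.2 := E.snd_baseP_nonneg u hw hw2 σ
  have hα : 0 < TraceCollar.αof q.1 := TraceCollar.αof_pos hX
  have hr : 0 < 2 * Real.exp (-q.2) := by positivity
  have hr2 : 2 * Real.exp (-q.2) ≤ 2 := by
    have : Real.exp (-q.2) ≤ 1 := Real.exp_le_one_iff.2 (by linarith)
    linarith
  have hs := E.collarTime_mem_Ioo hα
  obtain ⟨h1, -, -⟩ := E.dropA_radA_ptA_arg (E.ν₀_mem (u, (2 * Real.exp (-q.2)) • ((radialProjection (spherePt 1) w :
    Metric.sphere (0 : EuclideanSpace ℝ (Fin 2)) 1) : EuclideanSpace ℝ (Fin 2)))) hα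
  rw [P.collar_of_mem_closedTube ha ha' ⟨(u, w), ⟨mem_univ _, by simpa using hw2⟩, rfl⟩, cTube_apply, ptT, ptA]
  rw [E.collarInv_incl_of_mem P.jM P.jB (E.θ_mem_hbNbhd_of_mem (E.ν₀_mem _) hs) (by
    rw [h1, mem_closedTube_iff, norm_smul_coe_sphere hr.le]; exact hr2)]
  rw [E.ΨTube_ptT_arg P.jM hα hr, TraceCollar.ξ_αof, TubeNbhd.log_two_div, show (q.1, q.2) = q from rfl,
    E.Φ_baseP u hw σ]
  simp only [Real.log_exp, neg_neg]
  refine Prod.ext ?_ rfl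
  show P.jM (E.ν₀ (u, ‖w‖ • ((radialProjection (spherePt 1) w : Metric.sphere (0 : EuclideanSpace ℝ (Fin 2)) 1) :
    EuclideanSpace ℝ (Fin 2)))) = P.jM (E.ν₀ (u, w))
  rw [norm_smul_coe_radialProjection]

/-- **Branch F**: `collarInv (collar (y, σ)) = (y, σ)` on the core circle of the surgery torus. [folklore] -/
theorem collarInv_collar_core (v : Metric.sphere (0 : EuclideanSpace ℝ (Fin 2)) 1) (h : ((0 : EuclideanSpace ℝ (Fin 2)), v) ∈ solidTorus)
    (σ : ℝ) : E.collarInv P.jM P.jB (E.collar P.jM P.jB P.ψ (P.jB ⟨((0 : EuclideanSpace ℝ (Fin 2)), v), h⟩, σ)) =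
      (P.jB ⟨((0 : EuclideanSpace ℝ (Fin 2)), v), h⟩, σ) := by
  have hDpos : 0 < Real.exp (-σ) := Real.exp_pos _
  have hYd : 0 < TraceCollar.ψinv (Real.exp (-σ)) := TraceCollar.ψinv_pos _
  have hrpos : 0 < 2 * Real.exp (-TraceCollar.ψinv (Real.exp (-σ))) := by positivity
  have hr2 : 2 * Real.exp (-TraceCollar.ψinv (Real.exp (-σ))) < 2 := by
    have : Real.exp (-TraceCollar.ψinv (Real.exp (-σ))) < 1 := Real.exp_lt_one_iff.2 (by linarith)
    linarith
  have hrv : ‖(2 * Real.exp (-TraceCollar.ψinv (Real.exp (-σ)))) • (v : EuclideanSpace ℝ (Fin 2))‖ < 2 := by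
    rwa [norm_smul_coe_sphere hrpos.le]
  rw [P.collar_of_core v h, cFlat, TubeNbhd.fF]
  simp only [smul_zero]
  rw [E.collarInv_inr_zero, TubeNbhd.ΨFlat]
  have hκ : OpenPartialHomeomorph.univBall (0 : EuclideanSpace ℝ (Fin 2)) 2
      ((OpenPartialHomeomorph.univBall (0 : EuclideanSpace ℝ (Fin 2)) 2).symm
        ((2 * Real.exp (-TraceCollar.ψinv (Real.exp (-σ)))) • (v : EuclideanSpace ℝ (Fin 2)))) =
      (2 * Real.exp (-TraceCollar.ψinv (Real.exp (-σ)))) • (v : EuclideanSpace ℝ (Fin 2)) :=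
    TubeNbhd.univBall_apply_symm_apply hrv
  have hrad : TubeNbhd.radF ((0 : EuclideanSpace ℝ (Fin 2)), (OpenPartialHomeomorph.univBall (0 : EuclideanSpace ℝ (Fin 2)) 2).symm
      ((2 * Real.exp (-TraceCollar.ψinv (Real.exp (-σ)))) • (v : EuclideanSpace ℝ (Fin 2)))) =
      2 * Real.exp (-TraceCollar.ψinv (Real.exp (-σ))) := by
    rw [TubeNbhd.radF, hκ, norm_smul_coe_sphere hrpos.le]
  rw [hrad, hκ, radialProjection_smul _ hrpos, TubeNbhd.log_two_div, TraceCollar.ψ_ψinv hDpos, Real.log_exp,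
    neg_neg, smul_zero]
  refine Prod.ext ?_ rfl
  exact TubeNbhd.jBt_of_norm_lt P.jB (by simp)

/-- **`collarInv ∘ collar = id` on `Y × ℝ`.** [folklore] -/
theorem collarInv_collar (p : Y × ℝ) : E.collarInv P.jM P.jB (E.collar P.jM P.jB P.ψ p) = p := by
  obtain ⟨y, σ⟩ := p
  by_cases hy : y ∈ E.mSet P.jM
  · obtain ⟨a, ⟨ha, ha'⟩, rfl⟩ := hy
    by_cases hat : a ∈ E.closedTube
    · exact P.collarInv_collar_tube ha' hat σ
    · exact P.collarInv_collar_rad ha hat σ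
  · obtain ⟨v, h, rfl⟩ := P.eq_jB_zero_of_not_mem hy
    exact P.collarInv_collar_core v h σ

/-- The collar is injective. [folklore] -/
theorem collar_injective : Injective (E.collar P.jM P.jB P.ψ) :=
  (LeftInverse.injective fun p => P.collarInv_collar p)

end Presentation

end EndDatum

end FriendsTk

/-- **Helper `helper_friendsCarrier_Tk_endLeftInverse`** (registered on the crux item; end collar part 2 of
stub `helper_friendsCarrier_Tk`): for the relative open trace of the fibre-shrunken tube and a presentation
`(jM, ψ, jB)` of `Y` as `M_k` surgered along `K₀` via `ν₀`, the collar `c : Y × ℝ → T` (three formulas on an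
open cover: radial outside the closed tube, corner-turning profile over the tube, flat near the dual knot)
has the left inverse `collarInv`, hence is injective; outside the closed tube it is the radial formula
`c (jM a, σ) = incl (θ(s(αof e^{-σ}), a))`, and on the dual knot `c (jB (0, v), σ)` is the cocore point
`inr (0, univBall⁻¹ (2e^{-ψinv e^{-σ}} v))` (Kirby 1989, Ch. I §5). [cite: Kirby1989, Ch. I §5] -/
theorem helper_friendsCarrier_Tk_endLeftInverse : ∀ (k : ℕ) (K₀ : (sphere (0 : EuclideanSpace ℝ (Fin 2)) 1) → EuclideanSpace ℝ (Fin 4)) (ν₀ νK : (sphere (0 : EuclideanSpace ℝ (Fin 2)) 1) × EuclideanSpace ℝ (Fin 2) → EuclideanSpace ℝ (Fin 4)) (θ : ℝ × EuclideanSpace ℝ (Fin 4) → EuclideanSpace ℝ (Fin 4)) (δ : ℝ) (ι ι₀ : EuclideanSpace ℝ (Fin 4) → (sphere (0 : EuclideanSpace ℝ (Fin 2)) 1) × EuclideanSpace ℝ (Fin 2)), 0 < δ → δ < 1 → ContDiff ℝ ((⊤ : ℕ∞) : WithTop ℕ∞) θ → (∀ x, θ (0, x) = x) → (∀ t s x,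 θ (t, θ (s, x)) = θ (t + s, x)) → (∀ y : EuclideanSpace ℝ (Fin 4), (∀ j, (1 : ℝ) / 2 < holeTerm k j y) → levelFun k y ∈ Ioo (1 - δ) (1 + δ) → ∀ t : ℝ, levelFun k y + t ∈ Ioo (1 - δ) (1 + δ) → (∀ j, (1 : ℝ) / 2 < holeTerm k j (θ (t, y))) ∧ levelFun k (θ (t, y)) = levelFun k y + t) → (∀ a ∈ modelBoundary k, ∀ s ∈ Ioo (-δ) δ, (θ (s, a) ∈ modelHandlebody k ↔ s ≤ 0)) → ContMDiff ((𝓡 1).prod 𝓘(ℝ, EuclideanSpace ℝ (Fin 2))) 𝓘(ℝ, EuclideanSpace ℝ (Fin 4)) ((⊤ : ℕ∞) : WithTop ℕ∞) νK → (∀ p, νK p ∈ modelBoundary k) → IsOpen {y : EuclideanSpace ℝ (Fin 4) | (∀ j, (1 : ℝ) / 2 < holeTerm k j y) ∧ levelFun k y ∈ Ioo (1 - δ) (1 + δ) ∧ θ (1 - levelFun k y, y) ∈ range νK} → ContMDiffOn 𝓘(ℝ, EuclideanSpace ℝ (Fin 4)) ((𝓡 1).prod 𝓘(ℝ, EuclideanSpace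 ℝ (Fin 2))) ((⊤ : ℕ∞) : WithTop ℕ∞) ι {y : EuclideanSpace ℝ (Fin 4) | (∀ j, (1 : ℝ) / 2 < holeTerm k j y) ∧ levelFun k y ∈ Ioo (1 - δ) (1 + δ) ∧ θ (1 - levelFun k y, y) ∈ range νK} → (∀ q s, s ∈ Ioo (-δ) δ → ι (θ (s, νK q)) = q) → (∀ y ∈ {y : EuclideanSpace ℝ (Fin 4) | (∀ j, (1 : ℝ) / 2 < holeTerm k j y) ∧ levelFun k y ∈ Ioo (1 - δ) (1 + δ) ∧ θ (1 - levelFun k y, y) ∈ range νK}, θ (levelFun k y - 1, νK (ι y)) = y) → (∀ q, νK q = ν₀ (q.1, OpenPartialHomeomorph.univBall (0 : EuclideanSpace ℝ (Fin 2)) 2 q.2)) → ContMDiff ((𝓡 1).prod 𝓘(ℝ, EuclideanSpace ℝ (Fin 2))) 𝓘(ℝ, EuclideanSpace ℝ (Fin 4)) ((⊤ : ℕ∞) : WithTop ℕ∞) ν₀ → Injective ν₀ → (∀ p, ν₀ p ∈ modelBoundary k) → (∀ u, ν₀ (u, 0) = K₀ u) → IsOpen {y : EuclideanSpace ℝ (Fin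 4) | (∀ j, (1 : ℝ) / 2 < holeTerm k j y) ∧ levelFun k y ∈ Ioo (1 - δ) (1 + δ) ∧ θ (1 - levelFun k y, y) ∈ range ν₀} → ContMDiffOn 𝓘(ℝ, EuclideanSpace ℝ (Fin 4)) ((𝓡 1).prod 𝓘(ℝ, EuclideanSpace ℝ (Fin 2))) ((⊤ : ℕ∞) : WithTop ℕ∞) ι₀ {y : EuclideanSpace ℝ (Fin 4) | (∀ j, (1 : ℝ) / 2 < holeTerm k j y) ∧ levelFun k y ∈ Ioo (1 - δ) (1 + δ) ∧ θ (1 - levelFun k y, y) ∈ range ν₀} → (∀ q s, s ∈ Ioo (-δ) δ → ι₀ (θ (s, ν₀ q)) = q) → ∀ (Y : Type) [TopologicalSpace Y] [ChartedSpace (EuclideanSpace ℝ (Fin 3)) Y] (jB : solidTorus → Y) (jM : EuclideanSpace ℝ (Fin 4) → Y) (ψ : Y → EuclideanSpace ℝ (Fin 4)), Injective jB → (∀ x ∈ modelBoundary k, x ∉ range K₀ → ψ (jM x) = x) → jM '' {x : EuclideanSpace ℝ (Fin 4) | x ∈ modelBoundary k ∧ x ∉ range K₀} ∪ range jB = univ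 → (∀ x ∈ modelBoundary k, x ∉ range K₀ → ∀ b : solidTorus, jM x = jB b ↔ ∃ (u : (sphere (0 : EuclideanSpace ℝ (Fin 2)) 1)) (t : ℝ), t ∈ Ioo (0 : ℝ) 1 ∧ b.1.1 = t • (u : EuclideanSpace ℝ (Fin 2)) ∧ x = ν₀ (u, t • (b.1.2 : EuclideanSpace ℝ (Fin 2)))) → ∃ (X : Type) (_ : TopologicalSpace X) (_ : T2Space X) (_ : ChartedSpace (EuclideanSpace ℝ (Fin 4)) X) (_ : IsManifold (𝓡 4) ((⊤ : ℕ∞) : WithTop ℕ∞) X) (i : EuclideanSpace ℝ (Fin 4) → X) (h : EuclideanSpace ℝ (Fin 2) × EuclideanSpace ℝ (Fin 2) → X) (c : Y × ℝ → X) (cinv : X → Y × ℝ), (∀ p, cinv (c p) = p) ∧ Injective c ∧ (∀ (a : EuclideanSpace ℝ (Fin 4)) (σ : ℝ), a ∈ modelBoundary k → a ∉ ν₀ '' (univ ×ˢ closedBall (0 : EuclideanSpace ℝ (Fin 2)) 2) → c (jM a, σ) = i (θ (δ * (1 - TraceCollar.αof (Real.exp (-σ))) / (1 + TraceCollar.αof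 (Real.exp (-σ))), a))) ∧ (∀ (v : (sphere (0 : EuclideanSpace ℝ (Fin 2)) 1)) (b : solidTorus) (σ : ℝ), b.1 = (0, v) → c (jB b, σ) = h (0, (OpenPartialHomeomorph.univBall (0 : EuclideanSpace ℝ (Fin 2)) 2).symm ((2 * Real.exp (-TraceCollar.ψinv (Real.exp (-σ)))) • (v : EuclideanSpace ℝ (Fin 2))))) := by
  intro k K₀ ν₀ νK θ δ ι ι₀ hδ hδ1 hθ h0 hadd hclock hiff hν hmem hopen hι hιθ hθι hνK hν₀ hinj₀ hmem₀ hK₀ hopen₀ hι₀ hιθ₀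
    Y _ _ jB jM ψ hjB hψ hcov hrel
  let E : FriendsTk.EndDatum k :=
    { νK := νK, θ := θ, δ := δ, ι := ι, δ_pos := hδ, δ_lt_one := hδ1, contDiff_θ := hθ, θ_zero := h0, θ_add := hadd,
      clock := hclock, mem_modelHandlebody_iff := hiff, contMDiff_νK := hν, νK_mem := hmem, isOpen_flowTube' := hopen,
      contMDiffOn_ι := hι, ι_θ := hιθ, θ_ι := hθι, ν₀ := ν₀, K₀ := K₀, ι₀ := ι₀, νK_eq := hνK, contMDiff_ν₀ := hν₀,
      injective_ν₀ := hinj₀, ν₀_mem := hmem₀, ν₀_zero := hK₀, isOpen_flowTube₀ := hopen₀, contMDiffOn_ι₀ := hι₀,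
      ι₀_θ := hιθ₀ }
  let P : E.Presentation Y := ⟨jM, jB, ∅, ψ, hjB, hψ, hcov, hrel⟩
  refine ⟨E.Trace, inferInstance, inferInstance, inferInstance, inferInstance, E.incl, E.trGlueData.inr,
    E.collar P.jM P.jB P.ψ, E.collarInv P.jM P.jB, P.collarInv_collar, P.collar_injective, fun a σ ha hat => ?_,
    fun v b σ hb => ?_⟩
  · exact P.collar_of_not_mem_closedTube ha hat σ
  · have hmem' : ((0 : EuclideanSpace ℝ (Fin 2)), v) ∈ solidTorus := by simp [mem_solidTorus_iff]
    have hbeq : b = ⟨((0 : EuclideanSpace ℝ (Fin 2)), v), hmem'⟩ := Subtype.ext hb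
    subst hbeq
    rw [P.collar_of_core v hmem' σ]
    show E.trGlueData.inr (TubeNbhd.fF (((0 : EuclideanSpace ℝ (Fin 2)), v), σ)) = _
    simp only [TubeNbhd.fF, smul_zero]

end Summit.SmoothPoincare4.SmoothPoincare4.Theorems.DcrGap.MkFriends

end
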